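import Summits.BirchSwinnertonDyer.BirchSwinnertonDyer.Theorems.ManinLocalTwoThreeNegOneTwistIstarDeep
import HarnessLib

/-!
# S-an-63 «16 ∥ N descends», rows `I₃*/11` (twist `II*`, `f₂ = 3`) and `II*/12` (twist good, `f₂ = 0`) — Barrios et al. 2025 Thm. 5.1,
# rows I₃* and II* with `f = 4`, `d ≡ 3 (4)`, for `d = −1`
# (route `ManinLocalTwoThree`, crux C2 `ManinOddAtFour` stmt-BirchSwinnertonDyer-22967; cell bsd-f2-manin, an's candidate S-an-63; p3 gen 12)

Row `I₃*/11`: the deep normal form (first-test exit of round `1`) is `N = [2α, 2p, 8γ, 16q, 64r]` with `p, γ ∈ ℤ₂ˣ`, and `ord₂ Δ = 11`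
forces `α ∈ ℤ₂ˣ` (`isUnit_of_istarAForm_of_addVal`, `k = 0`).  Twist `T = [0, −(α²+2p), 0, 8(αγ+2q), −16(γ²+4r)]`; on
`(1, 0, 1, 4γ) • T = [2, −4c, 8γ, 16(κγ+q), −32(γ²+2r)]` Step 10 returns `II*` (`64 ∤ a₆` as `γ² + 2r ∈ ℤ₂ˣ`): `f = 11 + 1 − 9 = 3`.
Row `II*/12`: the Step-10 model `N = [2α₀, 4p, 8γ, 16q, 32r]`, `r ∈ ℤ₂ˣ`, has `ord₂ Δ = 12` iff `α₀ = 2α₁`, `γ ∈ ℤ₂ˣ`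
(`addVal_Δ_toNat_of_step10`); twist `T = [0, −4(α₁²+p), 0, 16(q+α₁γ), −16(γ²+2r)]` is not minimal: `(u, r, s, t) = (2, 0, 0, 4)` gives
`M = [0, −(α₁²+p), 1, q+α₁γ, −(1+g+g²+ρ)]` (`γ = 1+2g`, `r = 1+2ρ`) with odd discriminant: good reduction, `f = 0`.
HONEST FRAMING: local theorems in print, kernel-checked; nothing about BSD or Manin's conjecture is proved; C2 OPEN.
[cite: BarriosEtAl2025, Thm. 5.1 (arXiv:2501.03209 p. 16), rows I₃* (4,3) and II* (4,0)] [cite: SilvermanATAEC1994, IV.9.4 and IV.11.1]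
-/

set_option autoImplicit false
-- lint-debt: the directory name repeats the summit name (sibling precedent `ManinLocalTwoThreeNegOneTwistConductorAtTwo.lean`)
set_option linter.dupNamespace false

noncomputable section

open scoped Classical
open Polynomial IsLocalRing WeierstrassCurve
open IsDiscreteValuationRing hiding maximalIdeal
open Literature.NumberTheory.DiophantineGeometry Literature.NumberTheory.DiophantineGeometry.TateAlgorithm
  Literature.NumberTheory.DiophantineGeometry.TateAlgorithm.CharTwo

namespace Summit.BirchSwinnertonDyer.BirchSwinnertonDyer.Theorems.ManinLocalTwoThree

/-! ## §0 From a model of the twisted minimal model to a model of the twist -/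

/-- If `T ⊗ ℚ₂` is the `χ₋₄`-twist of (a `u = ·` translate of) the minimal model of `W` at `2` and `M ⊗ ℚ₂ ≅ T ⊗ ℚ₂`, then `M ⊗ ℚ₂` is a
model of `(W ⊗ (−1)) ⊗ ℚ₂`. [cite: SilvermanAEC2009, X.2 Prop. 2.4 and VII.1] -/
theorem exists_smul_eq_map_of_negTwist_model (W : WeierstrassCurve ℚ) (D : VariableChange ℤ_[2]) (T M : WeierstrassCurve ℤ_[2])
    (S : VariableChange ℚ_[2])
    (hNT : ((D • ((W.baseChange ℚ_[2]).minimal ℤ_[2]).integralModel ℤ_[2]).map (algebraMap ℤ_[2] ℚ_[2])).quadraticTwist (-1) =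
      T.map (algebraMap ℤ_[2] ℚ_[2]))
    (hM : M.map (algebraMap ℤ_[2] ℚ_[2]) = S • T.map (algebraMap ℤ_[2] ℚ_[2])) :
    ∃ Cfin : VariableChange ℚ_[2], M.map (algebraMap ℤ_[2] ℚ_[2]) = Cfin • (W.quadraticTwist ((-1 : ℤ) : ℚ)).baseChange ℚ_[2] := by
  haveI : Fact (Nat.Prime 2) := ⟨Nat.prime_two⟩
  set X : WeierstrassCurve ℚ_[2] := W.baseChange ℚ_[2] with hX
  set V₀ : WeierstrassCurve ℤ_[2] := (X.minimal ℤ_[2]).integralModel ℤ_[2] with hV₀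
  set E : VariableChange ℚ_[2] := (X.exists_isMinimal ℤ_[2]).choose with hE
  have hmin : X.minimal ℤ_[2] = E • X := rfl
  have hV₀X : V₀.baseChange ℚ_[2] = X.minimal ℤ_[2] := WeierstrassCurve.baseChange_integralModel_eq ℤ_[2] _
  set Xm : WeierstrassCurve ℚ_[2] := (W.quadraticTwist ((-1 : ℤ) : ℚ)).baseChange ℚ_[2] with hXm
  have hXmX : Xm = X.quadraticTwist (-1) := by
    rw [hXm, hX, WeierstrassCurve.baseChange, WeierstrassCurve.baseChange, WeierstrassCurve.map_quadraticTwist]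
    simp
  set Ctot : VariableChange ℚ_[2] := D.map (algebraMap ℤ_[2] ℚ_[2]) * E with hCtot
  have hCX : Ctot • X = (D • V₀).map (algebraMap ℤ_[2] ℚ_[2]) := by
    rw [hCtot, mul_smul, ← hmin, ← hV₀X]
    exact WeierstrassCurve.map_variableChange _ _ _
  set C₁ : VariableChange ℚ_[2] := ⟨Ctot.u, (-1) * Ctot.r, 0, 0⟩ with hC₁
  have hT : T.map (algebraMap ℤ_[2] ℚ_[2]) = C₁ • Xm := by
    rw [← hNT, ← hCX, WeierstrassCurve.quadraticTwist_smul, hXmX]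
  exact ⟨S * C₁, by rw [mul_smul, ← hT, hM]⟩

/-! ## §1 Row `I₃*/11`: the twist is of type `II*` -/

/-- Twist of the `I₃*` form `[2α, 2p, 8γ, 16q, 64r]`: `[0, −(α²+2p), 0, 8(αγ+2q), −16(γ²+4r)]`, read over `ℚ₂`.
[cite: SilvermanAEC2009, X.2 Prop. 2.4 (shape of the quadratic twist)] -/
theorem quadraticTwist_negOne_map_of_IstarThreeForm (N : WeierstrassCurve ℤ_[2]) {α p γ q r : ℤ_[2]}
    (h₁ : N.a₁ = 2 * α) (h₂ : N.a₂ = 2 * p) (h₃ : N.a₃ = 2 ^ 3 * γ) (h₄ : N.a₄ = 2 ^ 4 * q) (h₆ : N.a₆ = 2 ^ 6 * r) :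
    (N.map (algebraMap ℤ_[2] ℚ_[2])).quadraticTwist (-1) =
      (⟨0, -(α ^ 2 + 2 * p), 0, 8 * (α * γ + 2 * q), -(16 * (γ ^ 2 + 4 * r))⟩ : WeierstrassCurve ℤ_[2]).map
        (algebraMap ℤ_[2] ℚ_[2]) := by
  obtain ⟨a₁, a₂, a₃, a₄, a₆⟩ := N
  simp only at h₁ h₂ h₃ h₄ h₆
  subst h₁ h₂ h₃ h₄ h₆
  have c2 : ((2 : ℤ_[2]) : ℚ_[2]) = 2 := map_ofNat PadicInt.Coe.ringHom 2
  have c4 : ((4 : ℤ_[2]) : ℚ_[2]) = 4 := map_ofNat PadicInt.Coe.ringHom 4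
  have c8 : ((8 : ℤ_[2]) : ℚ_[2]) = 8 := map_ofNat PadicInt.Coe.ringHom 8
  have c16 : ((16 : ℤ_[2]) : ℚ_[2]) = 16 := map_ofNat PadicInt.Coe.ringHom 16
  ext <;> simp [WeierstrassCurve.quadraticTwist, WeierstrassCurve.map, WeierstrassCurve.b₂, WeierstrassCurve.b₄,
    WeierstrassCurve.b₆, c2, c4, c8, c16] <;> ring

/-- **The twist of the `I₃*/11`-form is of type `II*`** (`α = 1 + 2κ`, `p = 1 + 2ρ`, `γ ∈ ℤ₂ˣ`): Step 10 on
`(1, 0, 1, 4γ) • [0, −(α²+2p), 0, 8(αγ+2q), −16(γ²+4r)] = [2, −4(1+κ+κ²+ρ), 8γ, 16(κγ+q), −32(γ²+2r)]`.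
[cite: SilvermanATAEC1994, IV.9.4 Steps 1–10] -/
theorem kodairaSymbolOfMinimal_negTwist_IstarThree_IIstar {α p γ q r κ ρ : ℤ_[2]} (hα : α = 1 + 2 * κ) (hp : p = 1 + 2 * ρ)
    (hγ : IsUnit γ) :
    ((⟨1, 0, 1, 4 * γ⟩ : VariableChange ℤ_[2]) •
        (⟨0, -(α ^ 2 + 2 * p), 0, 8 * (α * γ + 2 * q), -(16 * (γ ^ 2 + 4 * r))⟩ : WeierstrassCurve ℤ_[2])).kodairaSymbolOfMinimal =
      .IIstar := by
  have hirr : Irreducible (2 : ℤ_[2]) := by exact_mod_cast PadicInt.irreducible_p (p := 2)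
  set T' : WeierstrassCurve ℤ_[2] := (⟨1, 0, 1, 4 * γ⟩ : VariableChange ℤ_[2]) •
    (⟨0, -(α ^ 2 + 2 * p), 0, 8 * (α * γ + 2 * q), -(16 * (γ ^ 2 + 4 * r))⟩ : WeierstrassCurve ℤ_[2]) with hT'
  have e1 : T'.a₁ = 2 * 1 := by rw [hT', variableChange_a₁]; simp
  have e2 : T'.a₂ = 2 ^ 2 * (-(1 + κ + κ ^ 2 + ρ)) := by
    rw [hT', variableChange_a₂]; simp; rw [hα, hp]; ring
  have e3 : T'.a₃ = 2 ^ 3 * γ := by rw [hT', variableChange_a₃]; simp; ring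
  have e4 : T'.a₄ = 2 ^ 4 * (κ * γ + q) := by
    rw [hT', variableChange_a₄]; simp; rw [hα]; ring
  have e6 : T'.a₆ = 2 ^ 5 * (-(γ ^ 2 + 2 * r)) := by rw [hT', variableChange_a₆]; simp; ring
  refine kodairaSymbolOfMinimal_eq_IIstar_of_step9 ?_ ?_ ?_ ?_ ?_ ?_ <;>
    try simp only [uniformizer_dvd_iff_two_dvd, uniformizer_pow_dvd_iff_two_pow_dvd]
  · rw [e1]; exact dvd_mul_right _ _
  · rw [e2]; exact dvd_mul_right _ _
  · rw [e3]; exact dvd_mul_right _ _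
  · rw [e4]; exact dvd_mul_right _ _
  · rw [e6]; exact dvd_mul_right _ _
  · rw [e6, show (2 : ℤ_[2]) ^ 6 = 2 ^ 5 * 2 by norm_num]
    intro h
    have h' : (2 : ℤ_[2]) ∣ -(γ ^ 2 + 2 * r) := (mul_dvd_mul_iff_left (by norm_num)).mp h
    have hu : IsUnit (-(γ ^ 2 + 2 * r)) := (isUnit_add_mul_of_isUnit hirr (hγ.pow 2) _).neg
    exact (isUnit_iff_not_dvd hirr _).mp hu h'

/-- **S-an-63, row `I₃*/11`** (Barrios et al. 2025 Thm. 5.1, row I₃*, `d ≡ 3 (4)`, kernel-checked for `d = −1`): if `W/ℚ` is of Kodaira type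
`I₃*` at `2` with `ord₂ Δ_min = 11` (the `f₂ = 4` stratum of type `I₃*`), then `f₂(W ⊗ (−1)) = 3` (type `II*`).
[cite: BarriosEtAl2025, Thm. 5.1 (arXiv:2501.03209 p. 16), row I₃*, (f, f^d) = (4,3)] [cite: SilvermanATAEC1994, IV.9.4 and IV.11.1] -/
theorem conductorExponent_quadraticTwist_negOne_of_IstarThree_eleven (W : WeierstrassCurve ℚ) [W.IsElliptic]
    (hK : W.kodairaSymbolAt ((Rat.HeightOneSpectrum.primesEquiv (R := ℤ)).symm ⟨2, Nat.prime_two⟩) = .Istar 3)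
    (hord : W.ordMinimalDiscriminant ((Rat.HeightOneSpectrum.primesEquiv (R := ℤ)).symm ⟨2, Nat.prime_two⟩) = 11) :
    (W.quadraticTwist ((-1 : ℤ) : ℚ)).conductorExponent ((Rat.HeightOneSpectrum.primesEquiv (R := ℤ)).symm ⟨2, Nat.prime_two⟩) = 3 := by
  haveI : Fact (Nat.Prime 2) := ⟨Nat.prime_two⟩
  haveI : Finite (ResidueField ℤ_[2]) := Finite.of_equiv _ (PadicInt.residueField (p := 2)).toEquiv.symm
  have hirr : Irreducible (2 : ℤ_[2]) := by exact_mod_cast PadicInt.irreducible_p (p := 2)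
  set v : IsDedekindDomain.HeightOneSpectrum ℤ := (Rat.HeightOneSpectrum.primesEquiv (R := ℤ)).symm ⟨2, Nat.prime_two⟩
    with hvdef
  have e : Rat.HeightOneSpectrum.primesEquiv (R := ℤ) v = ⟨2, Nat.prime_two⟩ := Equiv.apply_symm_apply _ _
  have hKp := WeierstrassCurve.kodairaSymbolAt_eq_padic (R := ℤ) v W
  rw [e] at hKp
  change W.kodairaSymbolAt v = (((W.baseChange ℚ_[2]).minimal ℤ_[2]).integralModel ℤ_[2]).kodairaSymbolOfMinimal at hKp
  have hOp := WeierstrassCurve.ordMinimalDiscriminant_eq_padic (R := ℤ) v W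
  rw [e] at hOp
  change W.ordMinimalDiscriminant v =
    (IsDiscreteValuationRing.addVal ℤ_[2] (((W.baseChange ℚ_[2]).minimal ℤ_[2]).integralModel ℤ_[2]).Δ).toNat at hOp
  set V₀ : WeierstrassCurve ℤ_[2] := ((W.baseChange ℚ_[2]).minimal ℤ_[2]).integralModel ℤ_[2] with hV₀
  rw [hK] at hKp
  rw [hord] at hOp
  -- the deep normal form: first-test exit of round 1
  obtain ⟨D, hu, h₁, h₂, h₂n, hbr⟩ := exists_smul_deep_of_kodairaSymbolOfMinimal_eq_Istar hirr V₀ hKp.symm (by norm_num)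
  have hm : ∀ {x : ℤ_[2]}, x ∈ maximalIdeal ℤ_[2] ↔ (2 : ℤ_[2]) ∣ x := fun {x} ↦ mem_maximalIdeal_iff_dvd_of_irreducible hirr x
  have hmn : ∀ {x : ℤ_[2]} {n : ℕ}, x ∈ maximalIdeal ℤ_[2] ^ n ↔ (2 : ℤ_[2]) ^ n ∣ x := fun {x n} ↦
    mem_maximalIdeal_pow_iff_dvd_of_irreducible hirr x n
  obtain ⟨α, hα⟩ := hm.mp h₁
  obtain ⟨p, hp⟩ := hm.mp h₂
  have hpu : IsUnit p := by
    rw [isUnit_iff_not_dvd hirr]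
    rintro ⟨p', hp'⟩
    exact h₂n (hmn.mpr ⟨p', by rw [hp, hp']; ring⟩)
  have hΔN : (IsDiscreteValuationRing.addVal ℤ_[2] (D • V₀).Δ).toNat = 11 := by rw [addVal_Δ_smul_toNat, ← hOp]
  rcases hbr with ⟨k, hnk, h₃, h₃n, h₄, h₆⟩ | ⟨k, hnk, -, -, -, -⟩
  swap
  · exfalso; omega
  obtain rfl : k = 1 := by omega
  obtain ⟨γ, hγ⟩ := hmn.mp h₃
  obtain ⟨q, hq⟩ := hmn.mp h₄
  obtain ⟨r, hr⟩ := hmn.mp h₆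
  have hγu : IsUnit γ := by
    rw [isUnit_iff_not_dvd hirr]
    rintro ⟨γ', hγ'⟩
    exact h₃n (hmn.mpr ⟨γ', by rw [hγ, hγ']; ring⟩)
  have hαu : IsUnit α :=
    isUnit_of_istarAForm_of_addVal hirr (D • V₀) 0 hα hp hpu (hγ.trans (by ring)) hγu (hq.trans (by ring)) (hr.trans (by ring))
      hΔN
  obtain ⟨κ, hκ⟩ := exists_eq_one_add_two_mul_of_isUnit_padicInt hαu
  obtain ⟨ρ, hρ⟩ := exists_eq_one_add_two_mul_of_isUnit_padicInt hpu
  have hNT := quadraticTwist_negOne_map_of_IstarThreeForm (D • V₀) hα hp (hγ.trans (by ring)) (hq.trans (by ring))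
    (hr.trans (by ring))
  set T : WeierstrassCurve ℤ_[2] := ⟨0, -(α ^ 2 + 2 * p), 0, 8 * (α * γ + 2 * q), -(16 * (γ ^ 2 + 4 * r))⟩ with hT
  set C₆ : VariableChange ℤ_[2] := ⟨1, 0, 1, 4 * γ⟩ with hC₆
  have hM : (C₆ • T).map (algebraMap ℤ_[2] ℚ_[2]) = (C₆.map (algebraMap ℤ_[2] ℚ_[2])) • T.map (algebraMap ℤ_[2] ℚ_[2]) :=
    (WeierstrassCurve.map_variableChange _ _ _).symm
  obtain ⟨Cfin, hCfin⟩ := exists_smul_eq_map_of_negTwist_model W D T (C₆ • T) _ hNT hM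
  have hexit : (C₆ • T).kodairaSymbolOfMinimal = .IIstar :=
    kodairaSymbolOfMinimal_negTwist_IstarThree_IIstar (q := q) (r := r) hκ hρ hγu
  have hΔT : (C₆ • T).Δ = (D • V₀).Δ := by
    have hΔQ : (T.Δ : ℚ_[2]) = ((D • V₀).Δ : ℚ_[2]) := by
      have h1 : (T.map (algebraMap ℤ_[2] ℚ_[2])).Δ = (((D • V₀).map (algebraMap ℤ_[2] ℚ_[2])).quadraticTwist (-1)).Δ := by
        rw [hNT]
      rw [WeierstrassCurve.map_Δ, WeierstrassCurve.quadraticTwist_Δ, WeierstrassCurve.map_Δ] at h1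
      norm_num at h1
      exact h1
    rw [Δ_smul_of_u_eq_one (show C₆.u = 1 from rfl)]
    exact IsFractionRing.injective ℤ_[2] ℚ_[2] hΔQ
  rw [conductorExponent_negTwist_of_exitModel W (C₆ • T) Cfin hCfin (by rw [hexit]; decide), hexit, hΔT, hΔN]
  rfl

/-! ## §2 Row `II*/12`: the twist has good reduction -/

/-- Twist of the `II*/12` form `[4α₁, 4p, 8γ, 16q, 32r]`: `[0, −4(α₁²+p), 0, 16(q+α₁γ), −16(γ²+2r)]`, read over `ℚ₂`.
[cite: SilvermanAEC2009, X.2 Prop. 2.4 (shape of the quadratic twist)] -/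
theorem quadraticTwist_negOne_map_of_IIstarTwelveForm (N : WeierstrassCurve ℤ_[2]) {α₁ p γ q r : ℤ_[2]}
    (h₁ : N.a₁ = 2 ^ 2 * α₁) (h₂ : N.a₂ = 2 ^ 2 * p) (h₃ : N.a₃ = 2 ^ 3 * γ) (h₄ : N.a₄ = 2 ^ 4 * q) (h₆ : N.a₆ = 2 ^ 5 * r) :
    (N.map (algebraMap ℤ_[2] ℚ_[2])).quadraticTwist (-1) =
      (⟨0, -(4 * (α₁ ^ 2 + p)), 0, 16 * (q + α₁ * γ), -(16 * (γ ^ 2 + 2 * r))⟩ : WeierstrassCurve ℤ_[2]).map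
        (algebraMap ℤ_[2] ℚ_[2]) := by
  obtain ⟨a₁, a₂, a₃, a₄, a₆⟩ := N
  simp only at h₁ h₂ h₃ h₄ h₆
  subst h₁ h₂ h₃ h₄ h₆
  have c2 : ((2 : ℤ_[2]) : ℚ_[2]) = 2 := map_ofNat PadicInt.Coe.ringHom 2
  have c4 : ((4 : ℤ_[2]) : ℚ_[2]) = 4 := map_ofNat PadicInt.Coe.ringHom 4
  have c16 : ((16 : ℤ_[2]) : ℚ_[2]) = 16 := map_ofNat PadicInt.Coe.ringHom 16
  ext <;> simp [WeierstrassCurve.quadraticTwist, WeierstrassCurve.map, WeierstrassCurve.b₂, WeierstrassCurve.b₄,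
    WeierstrassCurve.b₆, c2, c4, c16] <;> ring

/-- **The twist of the `II*/12`-form is not minimal**: `(u, r, s, t) = (2, 0, 0, 4)` takes `[0, −4(α₁²+p), 0, 16(q+α₁γ), −16(γ²+2r)]`
(`γ = 1 + 2g`, `r = 1 + 2ρ`) to the INTEGRAL model `M = [0, −(α₁²+p), 1, q+α₁γ, −(1+g+g²+ρ)]`. [cite: SilvermanAEC2009, III.1 Table 3.1] -/
theorem map_IIstarTwelveScaledModel {α₁ p γ q r g ρ : ℤ_[2]} (hγ : γ = 1 + 2 * g) (hr : r = 1 + 2 * ρ) :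
    ((⟨0, -(α₁ ^ 2 + p), 1, q + α₁ * γ, -(1 + g + g ^ 2 + ρ)⟩ : WeierstrassCurve ℤ_[2]).map (algebraMap ℤ_[2] ℚ_[2])) =
      (⟨Units.mk0 (2 : ℚ_[2]) two_ne_zero, 0, 0, 4⟩ : VariableChange ℚ_[2]) •
        ((⟨0, -(4 * (α₁ ^ 2 + p)), 0, 16 * (q + α₁ * γ), -(16 * (γ ^ 2 + 2 * r))⟩ : WeierstrassCurve ℤ_[2]).map
          (algebraMap ℤ_[2] ℚ_[2])) := by
  subst hγ hr
  have c2 : ((2 : ℤ_[2]) : ℚ_[2]) = 2 := map_ofNat PadicInt.Coe.ringHom 2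
  have c4 : ((4 : ℤ_[2]) : ℚ_[2]) = 4 := map_ofNat PadicInt.Coe.ringHom 4
  have c16 : ((16 : ℤ_[2]) : ℚ_[2]) = 16 := map_ofNat PadicInt.Coe.ringHom 16
  ext <;> simp only [variableChange_a₁, variableChange_a₂, variableChange_a₃, variableChange_a₄, variableChange_a₆,
    Units.val_inv_eq_inv_val, Units.val_mk0, map_a₁, map_a₂, map_a₃, map_a₄, map_a₆, PadicInt.algebraMap_apply,
    PadicInt.coe_mul, PadicInt.coe_add, PadicInt.coe_neg, PadicInt.coe_pow, PadicInt.coe_one, PadicInt.coe_zero, c2, c4, c16] <;>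
    field_simp <;> ring

/-- The rescaled model `[0, a, 1, b, c]` has odd discriminant `1 + 2J`. [cite: SilvermanAEC2009, III.1 (formulas for b₂, …, Δ)] -/
theorem Δ_IIstarTwelveScaledModel (a b c : ℤ_[2]) :
    (⟨0, a, 1, b, c⟩ : WeierstrassCurve ℤ_[2]).Δ =
      1 + 2 * (-32 * a ^ 3 * c - 8 * a ^ 3 + 8 * a ^ 2 * b ^ 2 + 144 * a * b * c + 36 * a * b - 32 * b ^ 3 - 216 * c ^ 2
        - 108 * c - 14) := by
  simp only [WeierstrassCurve.Δ, WeierstrassCurve.b₂, WeierstrassCurve.b₄, WeierstrassCurve.b₆, WeierstrassCurve.b₈]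
  ring

/-- **S-an-63, row `II*/12`** (Barrios et al. 2025 Thm. 5.1, row II*, `d ≡ 3 (4)`, kernel-checked for `d = −1`): if `W/ℚ` is of Kodaira type
`II*` at `2` with `ord₂ Δ_min = 12` (the `f₂ = 4` stratum of type `II*`), then `W ⊗ (−1)` has good reduction at `2`: `f₂(W ⊗ (−1)) = 0`.
[cite: BarriosEtAl2025, Thm. 5.1 (arXiv:2501.03209 p. 16), row II*, (f, f^d) = (4,0)] [cite: SilvermanATAEC1994, IV.9.4 Step 10 and IV.11.1] -/
theorem conductorExponent_quadraticTwist_negOne_of_IIstar_twelve (W : WeierstrassCurve ℚ) [W.IsElliptic]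
    (hK : W.kodairaSymbolAt ((Rat.HeightOneSpectrum.primesEquiv (R := ℤ)).symm ⟨2, Nat.prime_two⟩) = .IIstar)
    (hord : W.ordMinimalDiscriminant ((Rat.HeightOneSpectrum.primesEquiv (R := ℤ)).symm ⟨2, Nat.prime_two⟩) = 12) :
    (W.quadraticTwist ((-1 : ℤ) : ℚ)).conductorExponent ((Rat.HeightOneSpectrum.primesEquiv (R := ℤ)).symm ⟨2, Nat.prime_two⟩) = 0 := by
  haveI : Fact (Nat.Prime 2) := ⟨Nat.prime_two⟩
  haveI : Finite (ResidueField ℤ_[2]) := Finite.of_equiv _ (PadicInt.residueField (p := 2)).toEquiv.symm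
  have hirr : Irreducible (2 : ℤ_[2]) := by exact_mod_cast PadicInt.irreducible_p (p := 2)
  have hd0 : ((-1 : ℤ) : ℚ) ≠ 0 := by norm_num
  haveI := W.isElliptic_quadraticTwist hd0
  set v : IsDedekindDomain.HeightOneSpectrum ℤ := (Rat.HeightOneSpectrum.primesEquiv (R := ℤ)).symm ⟨2, Nat.prime_two⟩
    with hvdef
  have e : Rat.HeightOneSpectrum.primesEquiv (R := ℤ) v = ⟨2, Nat.prime_two⟩ := Equiv.apply_symm_apply _ _
  have hKp := WeierstrassCurve.kodairaSymbolAt_eq_padic (R := ℤ) v W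
  rw [e] at hKp
  change W.kodairaSymbolAt v = (((W.baseChange ℚ_[2]).minimal ℤ_[2]).integralModel ℤ_[2]).kodairaSymbolOfMinimal at hKp
  have hOp := WeierstrassCurve.ordMinimalDiscriminant_eq_padic (R := ℤ) v W
  rw [e] at hOp
  change W.ordMinimalDiscriminant v =
    (IsDiscreteValuationRing.addVal ℤ_[2] (((W.baseChange ℚ_[2]).minimal ℤ_[2]).integralModel ℤ_[2]).Δ).toNat at hOp
  set V₀ : WeierstrassCurve ℤ_[2] := ((W.baseChange ℚ_[2]).minimal ℤ_[2]).integralModel ℤ_[2] with hV₀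
  rw [hK] at hKp
  rw [hord] at hOp
  -- the Step-10 model
  obtain ⟨D, h₁, h₂, h₃, h₄, h₆, h₆n⟩ := Literature.NumberTheory.EllipticCurves.LocalIndex.exists_smul_of_kodairaSymbolOfMinimal_eq_IIstar V₀ hKp.symm
  have hm : ∀ {x : ℤ_[2]}, x ∈ maximalIdeal ℤ_[2] ↔ (2 : ℤ_[2]) ∣ x := fun {x} ↦ mem_maximalIdeal_iff_dvd_of_irreducible hirr x
  have hmn : ∀ {x : ℤ_[2]} {n : ℕ}, x ∈ maximalIdeal ℤ_[2] ^ n ↔ (2 : ℤ_[2]) ^ n ∣ x := fun {x n} ↦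
    mem_maximalIdeal_pow_iff_dvd_of_irreducible hirr x n
  obtain ⟨α₀, hα₀⟩ := hm.mp h₁
  obtain ⟨p, hp⟩ := hmn.mp h₂
  obtain ⟨γ, hγ⟩ := hmn.mp h₃
  obtain ⟨q, hq⟩ := hmn.mp h₄
  obtain ⟨r, hr⟩ := hmn.mp h₆
  have hru : IsUnit r := by
    rw [isUnit_iff_not_dvd hirr]
    rintro ⟨r', hr'⟩
    exact h₆n (hmn.mpr ⟨r', by rw [hr, hr']; ring⟩)
  have hΔN : (IsDiscreteValuationRing.addVal ℤ_[2] (D • V₀).Δ).toNat = 12 := by rw [addVal_Δ_smul_toNat, ← hOp]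
  obtain ⟨h11, h12, h14⟩ := addVal_Δ_toNat_of_step10 hirr (D • V₀) hα₀ hp hγ hq hr hru
  have hα₀u : ¬ IsUnit α₀ := fun h ↦ by have := h11 h; omega
  obtain ⟨α₁, hα₁⟩ := (not_isUnit_iff_dvd hirr _).mp hα₀u
  have hγu : IsUnit γ := by
    by_contra hγu
    obtain ⟨γ₁, hγ₁⟩ := (not_isUnit_iff_dvd hirr _).mp hγu
    have := h14 α₁ γ₁ hα₁ hγ₁; omega
  obtain ⟨g, hg⟩ := exists_eq_one_add_two_mul_of_isUnit_padicInt hγu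
  obtain ⟨ρ, hρ⟩ := exists_eq_one_add_two_mul_of_isUnit_padicInt hru
  have hNT := quadraticTwist_negOne_map_of_IIstarTwelveForm (D • V₀) (α₁ := α₁) (by rw [hα₀, hα₁]; ring) hp hγ hq hr
  have hM := map_IIstarTwelveScaledModel (α₁ := α₁) (p := p) (q := q) hg hρ
  obtain ⟨Cfin, hCfin⟩ := exists_smul_eq_map_of_negTwist_model W D _ _ _ hNT hM
  refine conductorExponent_two_eq_zero_of_unitModel _ _ Cfin hCfin ?_
  rw [Δ_IIstarTwelveScaledModel]
  exact isUnit_add_mul_of_isUnit hirr isUnit_one _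

end Summit.BirchSwinnertonDyer.BirchSwinnertonDyer.Theorems.ManinLocalTwoThree

end
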